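import Summits.QuantumFields.QCD.Theses.QuarksNoInfraredClause
import Literature.MathematicalPhysics.QuantumFieldTheory.QCDFlavourSymmetry
import Literature.MathematicalPhysics.QuantumFieldTheory.MassGapFromLatticeClustering
import Literature.MathematicalPhysics.QuantumFieldTheory.MassGapToLatticeClustering
import Literature.MathematicalPhysics.QuantumFieldTheory.MassGapTimeOrderedDetermined
import Summits.QuantumFields.QCD.Theorems.ThinQCD.Negative.FlavourGuard
import HarnessLib

/-!
# Stub `stub_continuumGapLaw` of line `registered` (crux `ThinQCD`, item stmt-QuantumFields-17278):
# where it sits among the filed items — a kernel-checked sandwich (supports file; the stub is NOT closed)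

The stub (S3 of the birth skeleton `Cruxes/ThinQCD/Lines/birth.lean`) is the ∀-law

  `∀ Nf sch T Δ₀, 0 < Δ₀ → 0 < b₀(N_f) → IsQCDAlong sch T → sch.HasNeutralLatticeMassGap Δ₀ →
     ∃ Δ, 0 < Δ ∧ 2Δ ≤ Δ₀ ∧ T.HasMassGap Δ`

("a neutral-sector lattice gap `Δ₀` of the scheme gives the full-spectrum continuum gap of every OS datum that
is QCD along it, at some rate `Δ ≤ Δ₀/2`").  This file does not prove it.  It records, sorry-free, what the
stub IS in terms of statements already filed in the tree, so that the lead can report it precisely: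

* `continuumGapLaw_of_torusHalfSpectrum_of_gapTransfer` — **upper bracket**: the sibling crux
  `QuarksNoInfraredClause.TorusHalfSpectrum` (stmt-QuantumFields-9508: neutral clustering at `2Δ` ⇒ all-pairs
  `HasLatticeMassGap Δ`, along asymptotically scaling schemes on the physical branch) and the support item
  `GradientFlowSpecies.GapTransfer` (stmt-QuantumFields-8923: `IsQCDAlong sch T → sch.HasLatticeMassGap Δ →
  T.HasMassGap Δ'` for `0 < Δ' < Δ`) together imply the stub, with `Δ = Δ₀/4` (HALF at `Δ₀/2`, then the
  transfer at `Δ₀/4 < Δ₀/2`; the two side conditions of HALF are the first two conjuncts of `IsQCDAlong`).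
* `existsGapTransfer_of_continuumGapLaw` — **lower bracket**: the stub implies the `∃`-form of `GapTransfer`
  restricted to `b₀ > 0` (`HasLatticeMassGap Δ₀ → ∃ Δ ∈ (0, Δ₀/2], T.HasMassGap Δ`), because the all-pairs
  lattice gap restricts to the neutral sector (`HasLatticeMassGap.neutral`).
* `continuumGapLaw_zero_flavour_of_gapTransfer`, `continuumGapLaw_zero_flavour_iff_existsGapTransfer` — **the quenched
  case is `GapTransfer` alone**: for `N_f = 0` the flavour torus `(ℂˣ)⁰` is trivial, every gauge-invariant local
  observable is flavour-neutral and `HasNeutralLatticeMassGap ↔ HasLatticeMassGap` (the refuter's landed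
  `ThinQCD.Negative.hasNeutralLatticeMassGap_iff_of_flavourless`, reused), and the stub at `N_f = 0` follows from
  `GapTransfer` with no half-spectrum input — indeed it IS the `∃`-form of `GapTransfer` for pure gauge — so the first named fact the stub is blocked on, independently of flavour physics, is
  `GapTransfer` (the lattice → continuum gap transfer for the smeared renormalised species fields; its own
  recorded kernel is the per-pair `∀ (A,B) ∃ C ∀ᶠ k` versus common-threshold `∃ k₀ ∀ (A,B)` uniformity —
  the "hidden light state" — plus Lüscher's trace formula for the time-periodic `qcdTorusExpect` and the
  `S → ∞` limit before `k → ∞`).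
* `continuumGapLaw_iff_speciesCSLaw` — **the stub is a purely lattice-side law**: by the landed equivalence
  `IsQCDAlong.hasSpeciesCSClustering_iff_hasMassGap` (MassGapToLatticeClustering) it is equivalent to
  "neutral per-pair lattice clustering at `Δ₀` ⇒ Cauchy–Schwarz clustering `sch.HasSpeciesCSClustering Δ`
  (`ClustersCS 4 (qcdLatticeSchwinger sch) Δ`) of the smeared renormalised species fields at some
  `Δ ≤ Δ₀/2`", for every scheme that carries SOME OS datum; the OS datum `T` is otherwise idle
  (`IsQCDAlong.hasMassGap_iff`: the gap clause is decided by the scheme on time-ordered test functions).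

Nothing here is new mathematics; no definition and no named fact is introduced.  References for the items:
Lüscher, Commun. Math. Phys. 54 (1977) 283; Osterwalder–Seiler, Ann. Phys. 110 (1978) §§2–4; Haag, *Local
Quantum Physics* (1996) Thm. II.5.4.1; Glimm–Jaffe, *Quantum Physics* (1987) §6.1.
-/

noncomputable section

namespace Summit.QuantumFields.QCD.Cruxes.ThinQCD.Registered

open Filter
open scoped Topology
open Literature.MathematicalPhysics.QuantumFieldTheory
open Summit.QuantumFields.QCD.Theses.QuarksNoInfraredClause (TorusHalfSpectrum)
open Summit.QuantumFields.QCD.Theorems.ThinQCD.Negative (hasNeutralLatticeMassGap_iff_of_flavourless)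

/-- **Record of item stmt-QuantumFields-8923 `GradientFlowSpecies.GapTransfer`** (support, open; route
GradientFlowSpecies): its LEDGER SIGNATURE VERBATIM (= the body of
`Summit.QuantumFields.QCD.Theses.GradientFlowSpecies.GapTransfer` in the current route file). The route file
`Theses/GradientFlowSpecies.lean` has not built since the 2026-08-16 re-type of the summit statement `QCD` (its
`closes` glue fails at :412; the items are unchanged), so this module lost its build although it only uses this
one item as a hypothesis. The former `open … GradientFlowSpecies (GapTransfer)` is replaced by this record in the
file's own namespace: the statement text of every theorem below is unchanged and denotes exactly the proposition
it was accepted for. If the planners restate item 8923, this record (and the conditional theorems below) speak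
about the signature recorded here (buildfix ops lane 2026-08-20; no accepted statement edited; a record of a
ledger ITEM, not a published fact). -/
def GapTransfer : Prop :=
  ∀ (Nf : ℕ) (sch : Literature.MathematicalPhysics.QuantumFieldTheory.QCDScheme Nf) (T : Literature.MathematicalPhysics.QuantumFieldTheory.OSData (Literature.MathematicalPhysics.QuantumFieldTheory.QCDField Nf) 4) (Δ Δ' : ℝ), 0 < Δ' → Δ' < Δ → Literature.MathematicalPhysics.QuantumFieldTheory.IsQCDAlong sch T → sch.HasLatticeMassGap Δ → T.HasMassGap Δ'

/-! ## Upper bracket: HALF ∧ GapTransfer ⇒ S3 -/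

/-- **The continuum gap law from the two filed items.**  `TorusHalfSpectrum` (stmt-QuantumFields-9508) and
`GradientFlowSpecies.GapTransfer` (stmt-QuantumFields-8923) imply the stub `stub_continuumGapLaw` of the
`ThinQCD` birth skeleton, verbatim, with the witness `Δ = Δ₀/4`: the neutral lattice gap `Δ₀ = 2·(Δ₀/2)`
(rewritten by `HasNeutralLatticeMassGap.mono`; the crux's inline neutral clause is `HasNeutralLatticeMassGap`
definitionally) gives `sch.HasLatticeMassGap (Δ₀/2)` by HALF — whose side conditions `HasAsymptoticScaling` and
the physical branch are the first two conjuncts of `IsQCDAlong sch T` — and the transfer gives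
`T.HasMassGap (Δ₀/4)`. -/
theorem continuumGapLaw_of_torusHalfSpectrum_of_gapTransfer
    (hH : TorusHalfSpectrum) (hG : GapTransfer) :
    ∀ (Nf : ℕ) (sch : QCDScheme Nf) (T : OSData (QCDField Nf) 4) (Δ₀ : ℝ),
      0 < Δ₀ → 0 < betaCoeff₀ Nf → IsQCDAlong sch T → sch.HasNeutralLatticeMassGap Δ₀ →
        ∃ Δ : ℝ, 0 < Δ ∧ 2 * Δ ≤ Δ₀ ∧ T.HasMassGap Δ := by
  intro Nf sch T Δ₀ hΔ₀ hb hT hN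
  have hN' : sch.HasNeutralLatticeMassGap (2 * (Δ₀ / 2)) := hN.mono (by linarith)
  have hL : sch.HasLatticeMassGap (Δ₀ / 2) :=
    hH Nf sch (Δ₀ / 2) (by positivity) hb hT.1 hT.2.1 hN'
  exact ⟨Δ₀ / 4, by positivity, by linarith,
    hG Nf sch T (Δ₀ / 2) (Δ₀ / 4) (by positivity) (by linarith) hT hL⟩

/-! ## Lower bracket: S3 ⇒ the `∃`-form of GapTransfer for `b₀ > 0` -/

/-- **The stub contains the `∃`-form of the lattice → continuum gap transfer** (for asymptotically free
flavour numbers): from the stub, `IsQCDAlong sch T` and the ALL-pairs lattice gap `sch.HasLatticeMassGap Δ₀`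
give `T.HasMassGap Δ` for some `0 < Δ ≤ Δ₀/2` — the all-pairs clause restricts to neutral pairs
(`QCDScheme.HasLatticeMassGap.neutral`). -/
theorem existsGapTransfer_of_continuumGapLaw
    (h : ∀ (Nf : ℕ) (sch : QCDScheme Nf) (T : OSData (QCDField Nf) 4) (Δ₀ : ℝ),
      0 < Δ₀ → 0 < betaCoeff₀ Nf → IsQCDAlong sch T → sch.HasNeutralLatticeMassGap Δ₀ →
        ∃ Δ : ℝ, 0 < Δ ∧ 2 * Δ ≤ Δ₀ ∧ T.HasMassGap Δ) :
    ∀ (Nf : ℕ) (sch : QCDScheme Nf) (T : OSData (QCDField Nf) 4) (Δ₀ : ℝ),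
      0 < Δ₀ → 0 < betaCoeff₀ Nf → IsQCDAlong sch T → sch.HasLatticeMassGap Δ₀ →
        ∃ Δ : ℝ, 0 < Δ ∧ 2 * Δ ≤ Δ₀ ∧ T.HasMassGap Δ :=
  fun Nf sch T Δ₀ hΔ₀ hb hT hL => h Nf sch T Δ₀ hΔ₀ hb hT hL.neutral

/-! ## The quenched case `N_f = 0`: every observable is neutral (`ThinQCD.Negative.FlavourGuard`), and S3 is GapTransfer alone -/

/-- **The quenched instance of the stub is `GapTransfer` alone** (witness `Δ = Δ₀/2`, from the transfer at
`Δ₀/2 < Δ₀`): no half-spectrum / spectrum-additivity input is involved at `N_f = 0`, so what blocks the stub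
first is the lattice → continuum gap transfer for the smeared renormalised (plaquette) field — the Yang–Mills
"hidden light state" kernel of item stmt-QuantumFields-8923. -/
theorem continuumGapLaw_zero_flavour_of_gapTransfer (hG : GapTransfer) :
    ∀ (sch : QCDScheme 0) (T : OSData (QCDField 0) 4) (Δ₀ : ℝ),
      0 < Δ₀ → 0 < betaCoeff₀ 0 → IsQCDAlong sch T → sch.HasNeutralLatticeMassGap Δ₀ →
        ∃ Δ : ℝ, 0 < Δ ∧ 2 * Δ ≤ Δ₀ ∧ T.HasMassGap Δ := by
  intro sch T Δ₀ hΔ₀ _ hT hN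
  exact ⟨Δ₀ / 2, by positivity, by linarith,
    hG 0 sch T Δ₀ (Δ₀ / 2) (by positivity) (by linarith) hT
      ((hasNeutralLatticeMassGap_iff_of_flavourless sch Δ₀).1 hN)⟩

/-- **At `N_f = 0` the stub IS the `∃`-form of the lattice → continuum gap transfer for pure `SU(3)` gauge
theory** (all-pairs lattice gap `Δ₀` + `IsQCDAlong` ⇒ continuum gap at some `Δ ∈ (0, Δ₀/2]`): the two
∀-laws are equivalent, kernel-checked (`b₀(0) = 11/(16π²) > 0` discharges the asymptotic-freedom guard). -/
theorem continuumGapLaw_zero_flavour_iff_existsGapTransfer :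
    (∀ (sch : QCDScheme 0) (T : OSData (QCDField 0) 4) (Δ₀ : ℝ),
      0 < Δ₀ → 0 < betaCoeff₀ 0 → IsQCDAlong sch T → sch.HasNeutralLatticeMassGap Δ₀ →
        ∃ Δ : ℝ, 0 < Δ ∧ 2 * Δ ≤ Δ₀ ∧ T.HasMassGap Δ) ↔
    (∀ (sch : QCDScheme 0) (T : OSData (QCDField 0) 4) (Δ₀ : ℝ),
      0 < Δ₀ → IsQCDAlong sch T → sch.HasLatticeMassGap Δ₀ →
        ∃ Δ : ℝ, 0 < Δ ∧ 2 * Δ ≤ Δ₀ ∧ T.HasMassGap Δ) := by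
  have b0_pos : 0 < betaCoeff₀ 0 := by
    unfold Literature.MathematicalPhysics.QuantumFieldTheory.betaCoeff₀; positivity
  exact ⟨fun h sch T Δ₀ hΔ₀ hT hL => h sch T Δ₀ hΔ₀ b0_pos hT hL.neutral,
    fun h sch T Δ₀ hΔ₀ _ hT hN =>
      h sch T Δ₀ hΔ₀ hT ((hasNeutralLatticeMassGap_iff_of_flavourless sch Δ₀).1 hN)⟩

/-! ## The stub is a lattice-side law (the OS datum is idle) -/

/-- **Lattice-side form of the stub.**  Along a QCD scheme the continuum gap clause `T.HasMassGap Δ` IS the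
Cauchy–Schwarz clustering `sch.HasSpeciesCSClustering Δ = ClustersCS 4 (qcdLatticeSchwinger sch) Δ` of the
smeared renormalised species fields (`IsQCDAlong.hasSpeciesCSClustering_iff_hasMassGap`), so the stub is
equivalent to: for every scheme carrying SOME OS datum along it, per-pair clustering of the flavour-neutral
gauge-invariant local observables at rate `Δ₀` forces species CS clustering at some rate `Δ ∈ (0, Δ₀/2]`. -/
theorem continuumGapLaw_iff_speciesCSLaw :
    (∀ (Nf : ℕ) (sch : QCDScheme Nf) (T : OSData (QCDField Nf) 4) (Δ₀ : ℝ),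
      0 < Δ₀ → 0 < betaCoeff₀ Nf → IsQCDAlong sch T → sch.HasNeutralLatticeMassGap Δ₀ →
        ∃ Δ : ℝ, 0 < Δ ∧ 2 * Δ ≤ Δ₀ ∧ T.HasMassGap Δ) ↔
    (∀ (Nf : ℕ) (sch : QCDScheme Nf) (Δ₀ : ℝ),
      0 < Δ₀ → 0 < betaCoeff₀ Nf → (∃ T : OSData (QCDField Nf) 4, IsQCDAlong sch T) →
        sch.HasNeutralLatticeMassGap Δ₀ →
          ∃ Δ : ℝ, 0 < Δ ∧ 2 * Δ ≤ Δ₀ ∧ sch.HasSpeciesCSClustering Δ) := by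
  constructor
  · rintro h Nf sch Δ₀ hΔ₀ hb ⟨T, hT⟩ hN
    obtain ⟨Δ, hΔ, h2, hgap⟩ := h Nf sch T Δ₀ hΔ₀ hb hT hN
    exact ⟨Δ, hΔ, h2, hT.hasSpeciesCSClustering_of_hasMassGap hgap⟩
  · intro h Nf sch T Δ₀ hΔ₀ hb hT hN
    obtain ⟨Δ, hΔ, h2, hcs⟩ := h Nf sch Δ₀ hΔ₀ hb ⟨T, hT⟩ hN
    exact ⟨Δ, hΔ, h2, hT.hasMassGap_of_hasSpeciesCSClustering hcs⟩

/-- **The OS datum is idle in the stub**: for two OS data `T, T'` that are QCD along the SAME scheme the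
conclusion of the stub has the same truth value (`IsQCDAlong.hasMassGap_iff`: both agree on all time-ordered
test functions), so no counterexample can come from re-choosing `T` off the tensors pinned by `IsQCDAlong`. -/
theorem continuumGapLaw_conclusion_iff_of_isQCDAlong {Nf : ℕ} {sch : QCDScheme Nf}
    {T T' : OSData (QCDField Nf) 4} (hT : IsQCDAlong sch T) (hT' : IsQCDAlong sch T') (Δ₀ : ℝ) :
    (∃ Δ : ℝ, 0 < Δ ∧ 2 * Δ ≤ Δ₀ ∧ T.HasMassGap Δ) ↔
      ∃ Δ : ℝ, 0 < Δ ∧ 2 * Δ ≤ Δ₀ ∧ T'.HasMassGap Δ := by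
  refine exists_congr fun Δ => ?_
  rw [hT.hasMassGap_iff hT' Δ]

end Summit.QuantumFields.QCD.Cruxes.ThinQCD.Registered

end
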